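import Literature.Topology.CoveringSpaces.CoveringGaloisCorrespondenceEquivalence
import Literature.AnabelianGeometry.Anabelioids.GaloisEquivalence
import Mathlib.CategoryTheory.Galois.Examples
import HarnessLib

/-!
# `Cov^fin(X)` is a Galois category (a connected anabelioid), with fibre functor the fibre at `x₀`

PROOF-ONLY companion (abc-iut cell, campaign-L R1 support, GAP row G-L4t14-R1; seat abc-iut-f-072).
[SGA1] Exp. V §4–§5 / [GeoAn] Def. 1.1.1 + Rmk. 1.1.1.1 («a connected anabelioid is the same as a Galois
category»): for `X` path connected and strongly locally contractible, the category `Cov^fin(X)` of finite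
covering spaces of `X` is a GALOIS CATEGORY — Mathlib `GaloisCategory`, i.e. a connected anabelioid in the
tree's dictionary (`Literature/AnabelianGeometry/Anabelioids/Basic.lean`) — and for every basepoint `x₀` the
fibre functor `E ↦ p⁻¹(x₀)` (abc-iut-w5-d144's `CovFin.fibreFunctor x₀`, the monodromy action forgotten) is a
FIBRE FUNCTOR (a basepoint `β : Ens_f → Cov^fin(X)` in [GeoAn] Def. 1.1.2 (ii)).  Both by transport along
the finite Galois correspondence `CovFin.galoisCorrespondence x₀ : CovFin X ≌ Action FintypeCat (π₁(X, x₀))`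
(Hatcher Thm. 1.38) from Mathlib's Galois category of finite `π₁`-sets (`CategoryTheory.Galois.Examples`),
using the tree's `galoisCategory_of_equivalence` / `nonempty_fiberFunctor_inverse_comp'`.
Theorems only (`GaloisCategory` is a `Prop`-valued class here; `FiberFunctor` is wrapped in `Nonempty`);
no instance is declared globally; nothing here bears on [IUTchIII] Cor. 3.12.
-/

noncomputable section

open CategoryTheory CategoryTheory.PreGaloisCategory

universe u

namespace Literature.Topology.CoveringSpaces.CovFin

open Literature.AnabelianGeometry.Anabelioids

variable {X : Type u} [TopologicalSpace X] [PathConnectedSpace X] [StronglyLocallyContractibleSpace X]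

/-- **`Cov^fin(X)` is a Galois category** (a connected anabelioid, [GeoAn] Rmk. 1.1.1.1) for `X` path
connected and strongly locally contractible — transport of Mathlib's `GaloisCategory (Action FintypeCat π₁)`
along `CovFin.galoisCorrespondence x₀`. [cite: SGA1, Exp. V §5] -/
theorem galoisCategory_of_basepoint (x₀ : X) : GaloisCategory (CovFin X) :=
  galoisCategory_of_equivalence (galoisCorrespondence (X := X) x₀).symm

/-- **`Cov^fin(X)` is a Galois category** (basepoint-free form: a path-connected space is nonempty).
[cite: SGA1, Exp. V §5] -/
theorem galoisCategory : GaloisCategory (CovFin X) := by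
  obtain ⟨x₀⟩ := (inferInstance : PathConnectedSpace X).nonempty
  exact galoisCategory_of_basepoint x₀

/-- **The fibre at `x₀` is a fibre functor of the Galois category `Cov^fin(X)`**: `E ↦ p_E⁻¹(x₀)` (the
finite `π₁`-set of `CovFin.fibreFunctor x₀` with its action forgotten) satisfies (G4)–(G6) — a basepoint of
the connected anabelioid `Cov^fin(X)` in the sense of [GeoAn] Def. 1.1.2 (ii). [cite: SGA1, Exp. V §5] -/
theorem nonempty_fiberFunctor_fibre (x₀ : X) :
    letI : GaloisCategory (CovFin X) := galoisCategory_of_basepoint x₀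
    Nonempty (FiberFunctor (fibreFunctor x₀ ⋙ Action.forget FintypeCat (FundamentalGroup X x₀))) :=
  nonempty_fiberFunctor_inverse_comp' (galoisCorrespondence (X := X) x₀).symm
    (Action.forget FintypeCat (FundamentalGroup X x₀))

end Literature.Topology.CoveringSpaces.CovFin
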